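import Mathlib
import HarnessLib

/-!
# Antipodal strong Harris–Kleitman inequality for sunflower labelings

Helper file for crux `stmt-CriticalPhenomena-4575` (`NoHeavyLowerTail`, route `PercNearOneGluingNoHeavy`),
new-inequality factory seat `prim-ineq-gen-1` (gen 2).  Everything here is PROVED; no definition of the
route is touched.

**Setting.**  A `k`-sunflower of up-sets of a finite Boolean lattice `2^S` (Gladkov, *Bull. Lond. Math.
Soc.* 56 (2024), Thm. 2.1: `H = A ⊔ C₁ ⊔ ⋯ ⊔ C_k ⊔ B` with every `A ∪ Cᵢ` closed upwards) is the same
thing as a map `f : 2^S → {B, C₁, …, C_k, A}` that is monotone for the order `B < Cᵢ < A` (petals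
pairwise incomparable).  Put `κ(A,B) = κ(B,A) = 1`, `κ(Cᵢ,Cⱼ) = −1` for `i ≠ j`, `κ = 0` otherwise.

**Theorem (antipodal strong Harris, this file).**  For two such labelings `g ≤ h` (pointwise),
`0 ≤ Σ_{X ⊆ S} κ(g(X), h(S ∖ X))`.
In words (`g = h`): among the antipodal pairs `(X, S ∖ X)` of the cube, the pairs labelled `(A,B)` or
`(B,A)` are at least as many as the ordered pairs labelled by two different petals.

This is a measure-free, profile-by-profile strengthening of Gladkov's Theorem 2.1 for product measures:
conditioning two i.i.d. samples of a product measure on the set of coordinates where they differ, the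
pair is a uniformly random antipodal pair of a sub-cube, and `μ(A)μ(B) − e₂(μ(C)) = ½ E[κ]`.
The proof is a five-line induction on `S`: `κ` is nonnegative on comparable pairs and submodular on
rectangles of comparable pairs (`kappa_submod`), so splitting off one coordinate,
`C(g,h) = C(g₀,h₁) + C(g₁,h₀) ≥ C(g₀,h₀) + C(g₁,h₁) ≥ 0`.
(Found and proved by this seat, 2026-08-19; not in Gladkov 2024 / Gladkov–Zimin 2024, whose proofs are a
coordinate induction on the masses resp. a switching lemma for percolation patterns.)
-/

namespace Summit.CriticalPhenomena.PercolationContinuityZ3.Theorems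

namespace AntipodalStrongHarris

/-- Labels of a `k`-sunflower decomposition: `bot` (the down-set `B`), `petal i` (the cell `Cᵢ`),
`top` (the up-set `A`). -/
inductive Lab (k : ℕ) where
  | bot : Lab k
  | petal : Fin k → Lab k
  | top : Lab k
  deriving DecidableEq

variable {k : ℕ}

namespace Lab

/-- The order `B < Cᵢ < A` with the petals pairwise incomparable. -/
instance instLE : LE (Lab k) := ⟨fun a b => a = bot ∨ b = top ∨ a = b⟩

/-- Unfolding of the label order: `a ≤ b` iff `a = B`, or `b = A`, or `a = b`. -/
theorem le_def (a b : Lab k) : a ≤ b ↔ a = bot ∨ b = top ∨ a = b := Iff.rfl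

/-- The label order is reflexive. -/
theorem le_rfl' (a : Lab k) : a ≤ a := Or.inr (Or.inr rfl)

/-- `B` is the least label. -/
theorem bot_le' (a : Lab k) : bot ≤ a := Or.inl rfl

/-- `A` is the greatest label. -/
theorem le_top' (a : Lab k) : a ≤ top := Or.inr (Or.inl rfl)

/-- The pair weight `κ`: `+1` on `{A,B}`-pairs, `−1` on pairs of two different petals, `0` otherwise. -/
def kappa : Lab k → Lab k → ℤ
  | top, bot => 1
  | bot, top => 1
  | petal i, petal j => if i = j then 0 else -1
  | _, _ => 0

/-- `κ` is nonnegative on comparable pairs (the value `−1` needs two incomparable petals). -/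
theorem kappa_nonneg_of_le {a b : Lab k} (hab : a ≤ b) : 0 ≤ kappa a b := by
  rw [le_def] at hab
  rcases a with _ | i | _ <;> rcases b with _ | j | _ <;> simp_all [kappa]

/-- **Submodularity of `κ` on rectangles of comparable pairs**: for `a₀ ≤ a₁` and `b₀ ≤ b₁`,
`κ(a₁,b₁) + κ(a₀,b₀) ≤ κ(a₁,b₀) + κ(a₀,b₁)` (twelve cases). -/
theorem kappa_submod {a₀ a₁ b₀ b₁ : Lab k} (ha : a₀ ≤ a₁) (hb : b₀ ≤ b₁) :
    kappa a₁ b₁ + kappa a₀ b₀ ≤ kappa a₁ b₀ + kappa a₀ b₁ := by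
  rw [le_def] at ha hb
  rcases a₀ with _ | i₀ | _ <;> rcases a₁ with _ | i₁ | _ <;> rcases b₀ with _ | j₀ | _ <;>
    rcases b₁ with _ | j₁ | _ <;> simp_all [kappa] <;> split_ifs <;> simp_all

end Lab

open Lab Finset

variable {α : Type*} [DecidableEq α]

/-- A sunflower labeling `f` of the subsets of a type is one with `X ⊆ Y → f X ≤ f Y`
(equivalently: `A = f⁻¹{top}` and every `A ∪ Cᵢ = f⁻¹{top, petal i}` are up-sets); its section
`X ↦ f (X ∪ {a})` is again one. -/
theorem monotone_comp_insert {f : Finset α → Lab k} (hf : ∀ ⦃X Y : Finset α⦄, X ⊆ Y → f X ≤ f Y)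
    (a : α) : ∀ ⦃X Y : Finset α⦄, X ⊆ Y → f (insert a X) ≤ f (insert a Y) :=
  fun _ _ hXY => hf (insert_subset_insert a hXY)

/-- The antipodal pairing sum `C_S(g,h) = Σ_{X ⊆ S} κ(g(X), h(S ∖ X))`. -/
def antipodalSum (S : Finset α) (g h : Finset α → Lab k) : ℤ :=
  ∑ X ∈ S.powerset, kappa (g X) (h (S \ X))

/-- Splitting off one coordinate: `C_{S ∪ {a}}(g,h) = C_S(g, h(· ∪ {a})) + C_S(g(· ∪ {a}), h)`. -/
theorem antipodalSum_insert {S : Finset α} {a : α} (ha : a ∉ S) (g h : Finset α → Lab k) :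
    antipodalSum (insert a S) g h =
      antipodalSum S g (fun X => h (insert a X)) + antipodalSum S (fun X => g (insert a X)) h := by
  unfold antipodalSum
  rw [sum_powerset_insert ha]
  congr 1
  · refine sum_congr rfl fun X hX => ?_
    have haX : a ∉ X := fun h' => ha (mem_powerset.mp hX h')
    rw [insert_sdiff_of_notMem S haX]
  · refine sum_congr rfl fun X hX => ?_
    have hXS : X ⊆ S := mem_powerset.mp hX
    congr 2
    ext x
    simp only [mem_sdiff, mem_insert]
    constructor
    · rintro ⟨h1 | h1, h2⟩
      · exact (h2 (Or.inl h1)).elim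
      · exact ⟨h1, fun hx => h2 (Or.inr hx)⟩
    · rintro ⟨h1, h2⟩
      refine ⟨Or.inr h1, ?_⟩
      rintro (rfl | hx)
      · exact ha h1
      · exact h2 hx

/-- **Antipodal strong Harris–Kleitman inequality.**  For sunflower labelings `g ≤ h` (pointwise in the
label order) of the subsets of a finite set `S`, `0 ≤ Σ_{X ⊆ S} κ(g(X), h(S ∖ X))`:
the `(A,B)`/`(B,A)` antipodal pairs outnumber the antipodal pairs carrying two different petals.
[new; strengthens Gladkov2024StrongFKG Thm. 2.1 for product measures] -/
theorem antipodalSum_nonneg (S : Finset α) :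
    ∀ g h : Finset α → Lab k, (∀ ⦃X Y : Finset α⦄, X ⊆ Y → g X ≤ g Y) →
      (∀ ⦃X Y : Finset α⦄, X ⊆ Y → h X ≤ h Y) → (∀ X, g X ≤ h X) → 0 ≤ antipodalSum S g h := by
  induction S using Finset.induction_on with
  | empty =>
    intro g h _ _ hgh
    simp only [antipodalSum, powerset_empty, sum_singleton, sdiff_self]
    exact kappa_nonneg_of_le (hgh ∅)
  | insert a S ha ih =>
    intro g h hg hh hgh
    rw [antipodalSum_insert ha]
    -- termwise submodularity: C(g,h₁) + C(g₁,h) ≥ C(g,h) + C(g₁,h₁)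
    have key : antipodalSum S g h + antipodalSum S (fun X => g (insert a X)) (fun X => h (insert a X)) ≤
        antipodalSum S g (fun X => h (insert a X)) + antipodalSum S (fun X => g (insert a X)) h := by
      unfold antipodalSum
      rw [← sum_add_distrib, ← sum_add_distrib]
      refine sum_le_sum fun X _ => ?_
      have h1 : g X ≤ g (insert a X) := hg (subset_insert a X)
      have h2 : h (S \ X) ≤ h (insert a (S \ X)) := hh (subset_insert a _)
      have := kappa_submod h1 h2
      linarith
    have ih₀ := ih g h hg hh hgh
    have ih₁ := ih (fun X => g (insert a X)) (fun X => h (insert a X)) (monotone_comp_insert hg a)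
      (monotone_comp_insert hh a) fun X => hgh (insert a X)
    linarith

/-- The diagonal case `g = h`: for one sunflower labeling `f` of `2^S`,
`0 ≤ Σ_{X ⊆ S} κ(f(X), f(S ∖ X))`, i.e.
`#{X : {f(X), f(S∖X)} = {A,B}} ≥ #{X : f(X), f(S∖X) are different petals}` (ordered counts). -/
theorem antipodalSum_self_nonneg (S : Finset α) (f : Finset α → Lab k)
    (hf : ∀ ⦃X Y : Finset α⦄, X ⊆ Y → f X ≤ f Y) : 0 ≤ antipodalSum S f f :=
  antipodalSum_nonneg S f f hf hf fun X => le_rfl' (f X)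

end AntipodalStrongHarris

end Summit.CriticalPhenomena.PercolationContinuityZ3.Theorems
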